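import Summits.Ventures.YMGap.RobustBall.HeatBathPoincareZdBallDLR
import Summits.Ventures.YMGap.RobustBall.LangevinPoincareZdBall
import Summits.Ventures.YMGap.RobustBall.LangevinPoincareDLRBall
import Summits.Ventures.YMGap.RobustBall.HeatBathConcentrationDLRBall
import Summits.Ventures.YMGap.Thresholds.OneLinkModulusSU3Twisted
import Literature.MathematicalPhysics.QuantumFieldTheory.Balaban1983to89.StrongCouplingKernelWindow
import HarnessLib

/-!
# Robust ball (Y2) — Poincaré inequalities uniformly on the `ℤ⁴` ball: every-`SU(N)` (Bakry–Émery modulus) and `SU(3)` (twisted modulus) cells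

HONEST FRAMING: venture file of the cell `pub-ymgap` (QuantumFields programme), track ROBUST-BALL, seat rb-p2 (g15); CELLS ONLY of five tree theorems —
`HeatBathPoincareZdBall.kernelVariance_le_onBall` (heat-bath Poincaré of every finite-volume kernel of every member, uniformly in the volume and the boundary
field), `HeatBathPoincareZd.gibbsVariance_le_onBall` (heat-bath Poincaré of EVERY DLR state of every member) `LangevinPoincare.kernel_variance_le_integral_Gam_onBall`
(gradient-form Poincaré of the kernels) `LangevinPoincare.gibbs_variance_le_integral_Gam_onBall` (gradient-form Poincaré of every DLR state of every
member) and `HeatBathConcentration.gibbs_measureReal_deviation_ge/le_le_onBall` (exponential concentration in every DLR state of every member) — whose only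
landed cells so far are `SU(2)` (quarter modulus).  Here: EVERY `SU(N)`, `N ≥ 2`, `d = 4`, on Shen–Zhu–Zhu's
printed Bakry–Émery window 't Hooft `0 ≤ b < 1/12` (one-link modulus `K = 1/(1/2 − 6b)`, hypothesis-free by the tree's `haarPoincare_SU`; the member conditions
force `b < 1/48` at zero loads), and `SU(3)`, `d = 4`, with engine-2's certified TWISTED modulus `OneLinkKRModulus 3 (1/5) (3531/2000)` (tree coupling `β_W/3`,
member conditions force `β_W < 1000/3531` at zero loads).  Members of the `ℤ⁴` ball: link potentials `W` with continuous own-link terms, support `supp` of range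
`R`, per-link loads `a` (oscillation), `ℓ_s` (self-Lipschitz), `Λ` (row cross-Lipschitz), `Λc` (column cross-Lipschitz).  LATTICE statements at STRONG COUPLING;
«gap» = Poincaré constant⁻¹ (no dynamics object); nothing about `β → ∞`, the continuum or Clay.  0 sorry, 0 definitions.
References: H. Shen, R. Zhu, X. Zhu, CMP 400 (2023) 805, Lemma 4.1 / Cor. 4.4; L. Wu, Ann. Probab. 34 (2006) 1960; D. W. Stroock, B. Zegarlinski, CMP 144 (1992) 303.
Everything here is proved. [folklore]
-/

noncomputable section

open scoped Matrix.Norms.Frobenius ContDiff Topology ProbabilityTheory NNReal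
open Finset MeasureTheory Filter ProbabilityTheory Function
open Literature.Probability.LatticeModels Literature.Probability.LatticeModels.DobrushinMetric
open Literature.MathematicalPhysics.QuantumLattice hiding torusNorm
open Literature.MathematicalPhysics.QuantumFieldTheory hiding ZdEdge
open Literature.MathematicalPhysics.QuantumFieldTheory.SUNBakryEmery (SUN)
open Literature.MathematicalPhysics.QuantumFieldTheory.Balaban1983to89.StrongCouplingDobrushinWindow (OneLinkKRModulus)
open Literature.MathematicalPhysics.QuantumFieldTheory.Balaban1983to89.StrongCouplingKernelWindow (oneLinkKRModulus_SU)
open Summit.Ventures.YMGap.LatticeBakryEmery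

namespace Summit.Ventures.YMGap.RobustBall

variable {N : ℕ}

/-- Arithmetic of the every-`N` Bakry–Émery column coefficient at `d = 4`: `6·3·|b|·(1/(1/2 − 6b))·X = (18b/(1/2 − 6b))·X` for `b ≥ 0`. [folklore] -/
private theorem coeff_bakryEmery_dim4 {b X Y : ℝ} (hb0 : 0 ≤ b) :
    6 * (((4 : ℕ) : ℝ) - 1) * |b| * (1 / (1 / 2 - 6 * b) * X * Y) = 18 * b / (1 / 2 - 6 * b) * (X * Y) := by
  rw [abs_of_nonneg hb0]; push_cast; ring

/-- Arithmetic of the `SU(3)` twisted column coefficient at `d = 4`: `6·3·|β_W/9|·((3531/2000)·X) = (3531β_W/1000)·X` for `β_W ≥ 0`. [folklore] -/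
private theorem coeff_pv2t_dim4 {βW X Y : ℝ} (h0 : 0 ≤ βW) :
    6 * (((4 : ℕ) : ℝ) - 1) * |βW / 9| * (3531 / 2000 * X * Y) = 3531 * βW / 1000 * (X * Y) := by
  rw [abs_of_nonneg (by positivity)]; push_cast; ring

namespace HeatBathPoincareZd

/-- ★★ **EVERY `SU(N)`, `N ≥ 2`, `d = 4` — THE HEAT-BATH POINCARÉ INEQUALITY OF EVERY GIBBS STATE OF EVERY MEMBER OF THE `ℤ⁴` BALL** (Bakry–Émery one-link modulus
`K = 1/(1/2 − 6b)`, 't Hooft `0 ≤ b < 1/12`, bare `Nb`): for a member with loads `(a, ℓ_s, Λ, Λc)` and range `R`, column condition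
`(18b/(1/2 − 6b)) e^{a}(1 + 2√N ℓ_s) + √N Λc ≤ c < 1` and row condition `(18b/(1/2 − 6b)) e^{a}(1 + 2√N ℓ_s) + √N Λ < 1`, EVERY DLR state `μ ∈ 𝒢(γ^W)` and every
Lipschitz cylinder `F` on `Δ` satisfy `Var_μ(F) ≤ (2(1−c))⁻¹ ∑_{x∈Δ} ∫∫ (F(U) − F(σ))² γ^W_{x}(dσ|U) μ(dU)` (at zero loads the window is `b < 1/48`). [folklore] -/
theorem suN_gibbsVariance_le_onBall_bakryEmery (hN : 2 ≤ N) {b a ℓs Λ Λc R c : ℝ} (hb0 : 0 ≤ b) (hb : b < 1 / 12) (hℓs : 0 ≤ ℓs)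
    {W : Potential (ZdEdge 4) (Matrix.specialUnitaryGroup (Fin N) ℂ)} (hWc : ∀ X, Continuous (W X))
    (hWdep : ∀ X, DependsOn (W X) (↑X : Set (ZdEdge 4)))
    {supp : Finset (ZdEdge 4) → Finset (Finset (ZdEdge 4))} (hsupp : W.IsSupportedBy supp)
    {osc : Finset (ZdEdge 4) → ZdEdge 4 → ℝ} (hosc : ∀ X, Dobrushin.IsOscBound (W X) (osc X))
    (hosca : ∀ e, ∑ X ∈ (supp {e}).filter (fun X => e ∈ X), osc X e ≤ a)
    {lip : Finset (ZdEdge 4) → ZdEdge 4 → ℝ} (hlip : ∀ X, IsLipBound suFrobDist (W X) (lip X))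
    (hlips : ∀ e, ∑ X ∈ (supp {e}).filter (fun X => e ∈ X), lip X e ≤ ℓs)
    (hΛ : ∀ e, ∑ y ∈ perturbedNbr supp e, ∑ X ∈ (supp {e}).filter (fun X => e ∈ X), lip X y ≤ Λ)
    (hcol : ∀ (y : ZdEdge 4) (T : Finset (ZdEdge 4)), y ∉ T → ∑ e ∈ T, ∑ X ∈ (supp {e}).filter (fun X => e ∈ X), lip X y ≤ Λc)
    (hR : ∀ e, ∀ X ∈ supp {e}, e ∈ X → ∀ y ∈ X, ‖e.1 - y.1‖ ≤ R)
    (hc : 18 * b / (1 / 2 - 6 * b) * (Real.exp a * (1 + 2 * Real.sqrt N * ℓs)) + Real.sqrt N * Λc ≤ c) (hc1 : c < 1)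
    (hrow : 18 * b / (1 / 2 - 6 * b) * (Real.exp a * (1 + 2 * Real.sqrt N * ℓs)) + Real.sqrt N * Λ < 1)
    {μ : Measure (LGConfig 4 (Matrix.specialUnitaryGroup (Fin N) ℂ))}
    (hμ : μ ∈ perturbedGibbsMeasures (d := 4) (fundamentalRep (Fin N)) (N * b) W supp)
    {F : LGConfig 4 (Matrix.specialUnitaryGroup (Fin N) ℂ) → ℝ} {Δ : Finset (ZdEdge 4)} {KF : ℝ≥0}
    (hF : IsLipschitzCylinder (fundamentalRep (Fin N)) F Δ KF) :
    ProbabilityTheory.variance F μ ≤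
      (2 * (1 - c))⁻¹ * ∑ x ∈ Δ, ∫ U, ∫ σ, (F U - F σ) ^ 2 ∂(perturbedYM (fundamentalRep (Fin N)) (N * b) W supp {x} U) ∂μ := by
  have habs : |b| = b := abs_of_nonneg hb0
  have e := coeff_bakryEmery_dim4 (X := Real.exp a) (Y := 1 + 2 * Real.sqrt N * ℓs) hb0
  exact gibbsVariance_le_onBall (d := 4) (by norm_num) (by omega) (β := b) (b := 6 * b) (K := 1 / (1 / 2 - 6 * b))
    (div_nonneg zero_le_one (by linarith)) hℓs (by rw [habs]; push_cast; linarith) (oneLinkKRModulus_SU hN (by linarith))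
    hWc hWdep hsupp hosc hosca hlip hlips hΛ hcol hR (c := c) (by rw [e]; exact hc) hc1
    (by rw [e]; exact hrow) hμ hF

/-- ★★ **`SU(3)`, `d = 4`, TWISTED MODULUS `OneLinkKRModulus 3 (1/5) (3531/2000)` — the heat-bath Poincaré inequality of every Gibbs state of every member of the `ℤ⁴`
ball** (tree coupling `β_W/3`, `0 ≤ β_W ≤ 3/10`): column condition `(3531β_W/1000) e^{a}(1 + 2√3 ℓ_s) + √3 Λc ≤ c < 1`, row condition
`(3531β_W/1000) e^{a}(1 + 2√3 ℓ_s) + √3 Λ < 1` ⇒ `Var_μ(F) ≤ (2(1−c))⁻¹ ∑_{x∈Δ} ∫∫ (F(U) − F(σ))² γ^W_{x}(dσ|U) μ(dU)` for EVERY DLR state of the member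
(zero loads: `β_W < 1000/3531`). [folklore] -/
theorem su3_gibbsVariance_le_onBall_pv2t {βW a ℓs Λ Λc R c : ℝ} (h0 : 0 ≤ βW) (h3 : βW ≤ 3 / 10) (hℓs : 0 ≤ ℓs)
    {W : Potential (ZdEdge 4) (Matrix.specialUnitaryGroup (Fin 3) ℂ)} (hWc : ∀ X, Continuous (W X))
    (hWdep : ∀ X, DependsOn (W X) (↑X : Set (ZdEdge 4)))
    {supp : Finset (ZdEdge 4) → Finset (Finset (ZdEdge 4))} (hsupp : W.IsSupportedBy supp)
    {osc : Finset (ZdEdge 4) → ZdEdge 4 → ℝ} (hosc : ∀ X, Dobrushin.IsOscBound (W X) (osc X))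
    (hosca : ∀ e, ∑ X ∈ (supp {e}).filter (fun X => e ∈ X), osc X e ≤ a)
    {lip : Finset (ZdEdge 4) → ZdEdge 4 → ℝ} (hlip : ∀ X, IsLipBound suFrobDist (W X) (lip X))
    (hlips : ∀ e, ∑ X ∈ (supp {e}).filter (fun X => e ∈ X), lip X e ≤ ℓs)
    (hΛ : ∀ e, ∑ y ∈ perturbedNbr supp e, ∑ X ∈ (supp {e}).filter (fun X => e ∈ X), lip X y ≤ Λ)
    (hcol : ∀ (y : ZdEdge 4) (T : Finset (ZdEdge 4)), y ∉ T → ∑ e ∈ T, ∑ X ∈ (supp {e}).filter (fun X => e ∈ X), lip X y ≤ Λc)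
    (hR : ∀ e, ∀ X ∈ supp {e}, e ∈ X → ∀ y ∈ X, ‖e.1 - y.1‖ ≤ R)
    (hc : 3531 * βW / 1000 * (Real.exp a * (1 + 2 * Real.sqrt 3 * ℓs)) + Real.sqrt 3 * Λc ≤ c) (hc1 : c < 1)
    (hrow : 3531 * βW / 1000 * (Real.exp a * (1 + 2 * Real.sqrt 3 * ℓs)) + Real.sqrt 3 * Λ < 1)
    {μ : Measure (LGConfig 4 (Matrix.specialUnitaryGroup (Fin 3) ℂ))}
    (hμ : μ ∈ perturbedGibbsMeasures (d := 4) (fundamentalRep (Fin 3)) (βW / 3) W supp)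
    {F : LGConfig 4 (Matrix.specialUnitaryGroup (Fin 3) ℂ) → ℝ} {Δ : Finset (ZdEdge 4)} {KF : ℝ≥0}
    (hF : IsLipschitzCylinder (fundamentalRep (Fin 3)) F Δ KF) :
    ProbabilityTheory.variance F μ ≤
      (2 * (1 - c))⁻¹ * ∑ x ∈ Δ, ∫ U, ∫ σ, (F U - F σ) ^ 2 ∂(perturbedYM (fundamentalRep (Fin 3)) (βW / 3) W supp {x} U) ∂μ := by
  have hβ : ((3 : ℕ) : ℝ) * (βW / 9) = βW / 3 := by push_cast; ring
  have habs : |βW / 9| = βW / 9 := abs_of_nonneg (by positivity)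
  have hμ9 : μ ∈ perturbedGibbsMeasures (d := 4) (fundamentalRep (Fin 3)) (((3 : ℕ) : ℝ) * (βW / 9)) W supp := by rwa [hβ]
  have e := coeff_pv2t_dim4 (X := Real.exp a) (Y := 1 + 2 * Real.sqrt ((3 : ℕ) : ℝ) * ℓs) h0
  have key := gibbsVariance_le_onBall (d := 4) (N := 3) (by norm_num) (by norm_num) (β := βW / 9) (b := 1 / 5) (K := 3531 / 2000)
    (by norm_num) hℓs (by rw [habs]; push_cast; linarith) TwistedBochner.su3_oneLinkKRModulus_pv2t_oneFifth
    hWc hWdep hsupp hosc hosca hlip hlips hΛ hcol hR (c := c) (by rw [e]; exact_mod_cast hc) hc1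
    (by rw [e]; exact_mod_cast hrow) hμ9 hF
  rw [hβ] at key
  exact key

end HeatBathPoincareZd

namespace HeatBathPoincareZdBall

/-- ★★ **EVERY `SU(N)`, `N ≥ 2`, `d = 4` — THE HEAT-BATH POINCARÉ INEQUALITY OF EVERY FINITE-VOLUME KERNEL OF EVERY MEMBER OF THE `ℤ⁴` BALL, uniformly in the
volume and the boundary field** (Bakry–Émery modulus `K = 1/(1/2 − 6b)`, 't Hooft `0 ≤ b < 1/12`, bare `Nb`): column condition
`(18b/(1/2 − 6b)) e^{a}(1 + 2√N ℓ_s) + √N Λc ≤ c < 1` ⇒ for EVERY finite `V`, EVERY boundary field `η` and every bounded measurable `F`,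
`Var_{γ^W_V(·|η)}(F) ≤ (2(1−c))⁻¹ ∑_{x∈V} ∫∫ (F − F(U[x ↦ g]))² ν^{W,U}_x(dg) γ^W_V(dU|η)`. [folklore] -/
theorem suN_kernelVariance_le_onBall_bakryEmery (hN : 2 ≤ N) {b a ℓs Λc c : ℝ} (hb0 : 0 ≤ b) (hb : b < 1 / 12) (hℓs : 0 ≤ ℓs)
    {W : Potential (ZdEdge 4) (Matrix.specialUnitaryGroup (Fin N) ℂ)} (hWc : ∀ X, Continuous (W X))
    (hWdep : ∀ X, DependsOn (W X) (↑X : Set (ZdEdge 4)))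
    {supp : Finset (ZdEdge 4) → Finset (Finset (ZdEdge 4))} (hsupp : W.IsSupportedBy supp)
    {osc : Finset (ZdEdge 4) → ZdEdge 4 → ℝ} (hosc : ∀ X, Dobrushin.IsOscBound (W X) (osc X))
    (hosca : ∀ e, ∑ X ∈ (supp {e}).filter (fun X => e ∈ X), osc X e ≤ a)
    {lip : Finset (ZdEdge 4) → ZdEdge 4 → ℝ} (hlip : ∀ X, IsLipBound suFrobDist (W X) (lip X))
    (hlips : ∀ e, ∑ X ∈ (supp {e}).filter (fun X => e ∈ X), lip X e ≤ ℓs)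
    (hcol : ∀ (y : ZdEdge 4) (T : Finset (ZdEdge 4)), y ∉ T → ∑ e ∈ T, ∑ X ∈ (supp {e}).filter (fun X => e ∈ X), lip X y ≤ Λc)
    (hc : 18 * b / (1 / 2 - 6 * b) * (Real.exp a * (1 + 2 * Real.sqrt N * ℓs)) + Real.sqrt N * Λc ≤ c) (hc1 : c < 1)
    {V : Finset (ZdEdge 4)} (hV : V.Nonempty) (η : LGConfig 4 (Matrix.specialUnitaryGroup (Fin N) ℂ))
    {F : LGConfig 4 (Matrix.specialUnitaryGroup (Fin N) ℂ) → ℝ} (hF : Measurable F) (hFb : ∃ M : ℝ, ∀ U, |F U| ≤ M) :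
    ProbabilityTheory.variance F (perturbedYM (fundamentalRep (Fin N)) (N * b) W supp V η) ≤
      (2 * (1 - c))⁻¹ * ∑ x ∈ V, ∫ U, ∫ σ, (F U - F σ) ^ 2 ∂(perturbedYM (fundamentalRep (Fin N)) (N * b) W supp {x} U)
        ∂(perturbedYM (fundamentalRep (Fin N)) (N * b) W supp V η) := by
  have habs : |b| = b := abs_of_nonneg hb0
  have e := coeff_bakryEmery_dim4 (X := Real.exp a) (Y := 1 + 2 * Real.sqrt N * ℓs) hb0
  exact kernelVariance_le_onBall (d := 4) (by norm_num) (by omega) (β := b) (b := 6 * b) (K := 1 / (1 / 2 - 6 * b))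
    (div_nonneg zero_le_one (by linarith)) hℓs (by rw [habs]; push_cast; linarith) (oneLinkKRModulus_SU hN (by linarith))
    hWc hWdep hsupp hosc hosca hlip hlips hcol (c := c) (by rw [e]; exact hc) hc1 hV η hF hFb

end HeatBathPoincareZdBall

namespace LangevinPoincare

/-- ★★ **EVERY `SU(N)`, `N ≥ 2`, `d = 4` — THE LANGEVIN (GRADIENT-FORM) POINCARÉ INEQUALITY OF EVERY FINITE-VOLUME KERNEL OF EVERY MEMBER OF THE `ℤ⁴` BALL,
uniformly in the volume and the boundary field** (Bakry–Émery modulus, 't Hooft `0 ≤ b < 1/12`, bare `Nb`): column condition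
`(18b/(1/2 − 6b)) e^{a}(1 + 2√N ℓ_s) + √N Λc ≤ c < 1` ⇒ for EVERY finite `V`, EVERY `η` and every smooth `f` of the link matrices over `V`,
`Var_{γ^W_V(·|η)}(f) ≤ e^{a}((1 − c)·N(1/2 − 6b))⁻¹ ∫ Γ(f,f) dγ^W_V(·|η)`. [folklore] -/
theorem suN_kernel_variance_le_integral_Gam_onBall_bakryEmery (hN : 2 ≤ N) {b a ℓs Λc c : ℝ} (hb0 : 0 ≤ b) (hb : b < 1 / 12)
    (hℓs : 0 ≤ ℓs)
    {W : Potential (ZdEdge 4) (SUN N)} (hWc : ∀ X, Continuous (W X)) (hWdep : ∀ X, DependsOn (W X) (↑X : Set (ZdEdge 4)))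
    {supp : Finset (ZdEdge 4) → Finset (Finset (ZdEdge 4))} (hsupp : W.IsSupportedBy supp)
    {osc : Finset (ZdEdge 4) → ZdEdge 4 → ℝ} (hosc : ∀ X, Dobrushin.IsOscBound (W X) (osc X))
    (hosca : ∀ e, ∑ X ∈ (supp {e}).filter (fun X => e ∈ X), osc X e ≤ a)
    {lip : Finset (ZdEdge 4) → ZdEdge 4 → ℝ} (hlip : ∀ X, IsLipBound suFrobDist (W X) (lip X))
    (hlips : ∀ e, ∑ X ∈ (supp {e}).filter (fun X => e ∈ X), lip X e ≤ ℓs)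
    (hcol : ∀ (y : ZdEdge 4) (T : Finset (ZdEdge 4)), y ∉ T → ∑ e ∈ T, ∑ X ∈ (supp {e}).filter (fun X => e ∈ X), lip X y ≤ Λc)
    (hc : 18 * b / (1 / 2 - 6 * b) * (Real.exp a * (1 + 2 * Real.sqrt N * ℓs)) + Real.sqrt N * Λc ≤ c) (hc1 : c < 1)
    (V : Finset (ZdEdge 4)) (η : LGConfig 4 (SUN N)) {f : Cfg ↥V N → ℝ} (hf : ContDiff ℝ ∞ f) :
    Var[matrixCylinder V f; perturbedYM (fundamentalRep (Fin N)) ((N : ℝ) * b) W supp V η] ≤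
      Real.exp a * ((1 - c) * ((N : ℝ) * (1 / 2 - 6 * b)))⁻¹ *
        ∫ U, Gam f f (fun e : ↥V => (U e : Matrix (Fin N) (Fin N) ℂ)) ∂(perturbedYM (fundamentalRep (Fin N)) ((N : ℝ) * b) W supp V η) := by
  have habs : |b| = b := abs_of_nonneg hb0
  have hN0 : (0 : ℝ) < N := by exact_mod_cast (show 0 < N by omega)
  have e := coeff_bakryEmery_dim4 (X := Real.exp a) (Y := 1 + 2 * Real.sqrt N * ℓs) hb0
  have hK₀ : 0 < (N : ℝ) / 2 - N * |b| * (2 * (((4 : ℕ) : ℝ) - 1)) := by rw [habs]; push_cast; nlinarith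
  have key := kernel_variance_le_integral_Gam_onBall (d := 4) (by norm_num) (by omega) (β := b) (b := 6 * b) (K := 1 / (1 / 2 - 6 * b))
    (div_nonneg zero_le_one (by linarith)) hℓs (by rw [habs]; push_cast; linarith) (oneLinkKRModulus_SU hN (by linarith))
    hWc hWdep hsupp hosc hosca hlip hlips hcol (c := c) (by rw [e]; exact hc) hc1 hK₀ V η hf
  have e' : (N : ℝ) / 2 - N * |b| * (2 * (((4 : ℕ) : ℝ) - 1)) = N * (1 / 2 - 6 * b) := by rw [habs]; push_cast; ring
  rw [e'] at key
  exact key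

/-- ★★ **EVERY `SU(N)`, `N ≥ 2`, `d = 4` — THE LANGEVIN (GRADIENT-FORM) POINCARÉ INEQUALITY OF EVERY GIBBS STATE OF EVERY MEMBER OF THE `ℤ⁴` BALL**
(Bakry–Émery modulus, 't Hooft `0 ≤ b < 1/12`, bare `Nb`): column condition `(18b/(1/2 − 6b)) e^{a}(1 + 2√N ℓ_s) + √N Λc ≤ c < 1` and row condition
`(18b/(1/2 − 6b)) e^{a}(1 + 2√N ℓ_s) + √N Λ < 1` ⇒ for EVERY DLR state `μ ∈ 𝒢(γ^W)` and every smooth `f` of the link matrices over a finite `V`,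
`Var_μ(f) ≤ e^{a}((1 − c)·N(1/2 − 6b))⁻¹ ∫ Γ(f,f) dμ`. [folklore] -/
theorem suN_gibbs_variance_le_integral_Gam_onBall_bakryEmery (hN : 2 ≤ N) {b a ℓs Λ Λc R c : ℝ} (hb0 : 0 ≤ b) (hb : b < 1 / 12)
    (hℓs : 0 ≤ ℓs)
    {W : Potential (ZdEdge 4) (SUN N)} (hWc : ∀ X, Continuous (W X)) (hWdep : ∀ X, DependsOn (W X) (↑X : Set (ZdEdge 4)))
    {supp : Finset (ZdEdge 4) → Finset (Finset (ZdEdge 4))} (hsupp : W.IsSupportedBy supp)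
    {osc : Finset (ZdEdge 4) → ZdEdge 4 → ℝ} (hosc : ∀ X, Dobrushin.IsOscBound (W X) (osc X))
    (hosca : ∀ e, ∑ X ∈ (supp {e}).filter (fun X => e ∈ X), osc X e ≤ a)
    {lip : Finset (ZdEdge 4) → ZdEdge 4 → ℝ} (hlip : ∀ X, IsLipBound suFrobDist (W X) (lip X))
    (hlips : ∀ e, ∑ X ∈ (supp {e}).filter (fun X => e ∈ X), lip X e ≤ ℓs)
    (hΛ : ∀ e, ∑ y ∈ perturbedNbr supp e, ∑ X ∈ (supp {e}).filter (fun X => e ∈ X), lip X y ≤ Λ)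
    (hcol : ∀ (y : ZdEdge 4) (T : Finset (ZdEdge 4)), y ∉ T → ∑ e ∈ T, ∑ X ∈ (supp {e}).filter (fun X => e ∈ X), lip X y ≤ Λc)
    (hR : ∀ e, ∀ X ∈ supp {e}, e ∈ X → ∀ y ∈ X, ‖e.1 - y.1‖ ≤ R)
    (hc : 18 * b / (1 / 2 - 6 * b) * (Real.exp a * (1 + 2 * Real.sqrt N * ℓs)) + Real.sqrt N * Λc ≤ c) (hc1 : c < 1)
    (hrow : 18 * b / (1 / 2 - 6 * b) * (Real.exp a * (1 + 2 * Real.sqrt N * ℓs)) + Real.sqrt N * Λ < 1)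
    {μ : Measure (LGConfig 4 (SUN N))} (hμ : μ ∈ perturbedGibbsMeasures (d := 4) (fundamentalRep (Fin N)) ((N : ℝ) * b) W supp)
    (V : Finset (ZdEdge 4)) {f : Cfg ↥V N → ℝ} (hf : ContDiff ℝ ∞ f) :
    Var[matrixCylinder V f; μ] ≤
      Real.exp a * ((1 - c) * ((N : ℝ) * (1 / 2 - 6 * b)))⁻¹ * ∫ U, Gam f f (fun e : ↥V => (U e : Matrix (Fin N) (Fin N) ℂ)) ∂μ := by
  have habs : |b| = b := abs_of_nonneg hb0
  have hN0 : (0 : ℝ) < N := by exact_mod_cast (show 0 < N by omega)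
  have e := coeff_bakryEmery_dim4 (X := Real.exp a) (Y := 1 + 2 * Real.sqrt N * ℓs) hb0
  have hK₀ : 0 < (N : ℝ) / 2 - N * |b| * (2 * (((4 : ℕ) : ℝ) - 1)) := by rw [habs]; push_cast; nlinarith
  have key := gibbs_variance_le_integral_Gam_onBall (d := 4) (by norm_num) (by omega) (β := b) (b := 6 * b) (K := 1 / (1 / 2 - 6 * b))
    (div_nonneg zero_le_one (by linarith)) hℓs (by rw [habs]; push_cast; linarith) (oneLinkKRModulus_SU hN (by linarith))
    hWc hWdep hsupp hosc hosca hlip hlips hΛ hcol hR (c := c) (by rw [e]; exact hc) hc1 (by rw [e]; exact hrow) hK₀ hμ V hf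
  have e' : (N : ℝ) / 2 - N * |b| * (2 * (((4 : ℕ) : ℝ) - 1)) = N * (1 / 2 - 6 * b) := by rw [habs]; push_cast; ring
  rw [e'] at key
  exact key

end LangevinPoincare

namespace HeatBathConcentration

/-- ★★ **EVERY `SU(N)`, `N ≥ 2`, `d = 4` — EXPONENTIAL CONCENTRATION IN EVERY GIBBS STATE OF EVERY MEMBER OF THE `ℤ⁴` BALL, both tails** (Bakry–Émery modulus,
't Hooft `0 ≤ b < 1/12`, bare `Nb`): column condition `(18b/(1/2 − 6b)) e^{a}(1 + 2√N ℓ_s) + √N Λc ≤ c < 1` and row condition `… + √N Λ < 1` ⇒ for EVERY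
DLR state `μ ∈ 𝒢(γ^W)`, every Lipschitz cylinder `F` on `Δ` with link oscillations `δ_x` (`∑ δ_x² > 0`) and every `r`:
`μ{F − E_μF ≥ r}, μ{F − E_μF ≤ −r} ≤ e^{2/3} exp(−r/√(2(2(1−c))⁻¹ ∑_{x∈Δ} δ_x²))`. [folklore] -/
theorem suN_gibbs_measureReal_deviation_le_onBall_bakryEmery (hN : 2 ≤ N) {b a ℓs Λ Λc R c : ℝ} (hb0 : 0 ≤ b) (hb : b < 1 / 12) (hℓs : 0 ≤ ℓs)
    {W : Potential (ZdEdge 4) (Matrix.specialUnitaryGroup (Fin N) ℂ)} (hWc : ∀ X, Continuous (W X))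
    (hWdep : ∀ X, DependsOn (W X) (↑X : Set (ZdEdge 4)))
    {supp : Finset (ZdEdge 4) → Finset (Finset (ZdEdge 4))} (hsupp : W.IsSupportedBy supp)
    {osc : Finset (ZdEdge 4) → ZdEdge 4 → ℝ} (hosc : ∀ X, Dobrushin.IsOscBound (W X) (osc X))
    (hosca : ∀ e, ∑ X ∈ (supp {e}).filter (fun X => e ∈ X), osc X e ≤ a)
    {lip : Finset (ZdEdge 4) → ZdEdge 4 → ℝ} (hlip : ∀ X, IsLipBound suFrobDist (W X) (lip X))
    (hlips : ∀ e, ∑ X ∈ (supp {e}).filter (fun X => e ∈ X), lip X e ≤ ℓs)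
    (hΛ : ∀ e, ∑ y ∈ perturbedNbr supp e, ∑ X ∈ (supp {e}).filter (fun X => e ∈ X), lip X y ≤ Λ)
    (hcol : ∀ (y : ZdEdge 4) (T : Finset (ZdEdge 4)), y ∉ T → ∑ e ∈ T, ∑ X ∈ (supp {e}).filter (fun X => e ∈ X), lip X y ≤ Λc)
    (hR : ∀ e, ∀ X ∈ supp {e}, e ∈ X → ∀ y ∈ X, ‖e.1 - y.1‖ ≤ R)
    (hc : 18 * b / (1 / 2 - 6 * b) * (Real.exp a * (1 + 2 * Real.sqrt N * ℓs)) + Real.sqrt N * Λc ≤ c) (hc1 : c < 1)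
    (hrow : 18 * b / (1 / 2 - 6 * b) * (Real.exp a * (1 + 2 * Real.sqrt N * ℓs)) + Real.sqrt N * Λ < 1)
    {μ : Measure (LGConfig 4 (Matrix.specialUnitaryGroup (Fin N) ℂ))}
    (hμ : μ ∈ perturbedGibbsMeasures (d := 4) (fundamentalRep (Fin N)) (N * b) W supp)
    {F : LGConfig 4 (Matrix.specialUnitaryGroup (Fin N) ℂ) → ℝ} {Δ : Finset (ZdEdge 4)} {KF : ℝ≥0}
    (hF : IsLipschitzCylinder (fundamentalRep (Fin N)) F Δ KF) (δ : ZdEdge 4 → ℝ)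
    (hδ : ∀ x ∈ Δ, ∀ U s, |F U - F (update U x s)| ≤ δ x) (hD : 0 < ∑ x ∈ Δ, δ x ^ 2) (r : ℝ) :
    μ.real {U | r ≤ F U - ∫ U', F U' ∂μ} ≤ Real.exp (2 / 3) * Real.exp (-r / Real.sqrt (2 * (2 * (1 - c))⁻¹ * ∑ x ∈ Δ, δ x ^ 2)) ∧
      μ.real {U | F U - ∫ U', F U' ∂μ ≤ -r} ≤ Real.exp (2 / 3) * Real.exp (-r / Real.sqrt (2 * (2 * (1 - c))⁻¹ * ∑ x ∈ Δ, δ x ^ 2)) := by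
  have habs : |b| = b := abs_of_nonneg hb0
  have e := coeff_bakryEmery_dim4 (X := Real.exp a) (Y := 1 + 2 * Real.sqrt N * ℓs) hb0
  exact ⟨gibbs_measureReal_deviation_ge_le_onBall (d := 4) (by norm_num) (by omega) (β := b) (b := 6 * b) (K := 1 / (1 / 2 - 6 * b))
      (div_nonneg zero_le_one (by linarith)) hℓs (by rw [habs]; push_cast; linarith) (oneLinkKRModulus_SU hN (by linarith))
      hWc hWdep hsupp hosc hosca hlip hlips hΛ hcol hR (c := c) (by rw [e]; exact hc) hc1 (by rw [e]; exact hrow) hμ hF δ hδ hD r,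
    gibbs_measureReal_deviation_le_le_onBall (d := 4) (by norm_num) (by omega) (β := b) (b := 6 * b) (K := 1 / (1 / 2 - 6 * b))
      (div_nonneg zero_le_one (by linarith)) hℓs (by rw [habs]; push_cast; linarith) (oneLinkKRModulus_SU hN (by linarith))
      hWc hWdep hsupp hosc hosca hlip hlips hΛ hcol hR (c := c) (by rw [e]; exact hc) hc1 (by rw [e]; exact hrow) hμ hF δ hδ hD r⟩

end HeatBathConcentration

end Summit.Ventures.YMGap.RobustBall

end
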